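import Summits.BirchSwinnertonDyer.BirchSwinnertonDyer.Theorems.OneSidedTwistSqueezeX9KatoDivisibilityX9OfGradedEulerLossLattice
import HarnessLib

set_option autoImplicit false

-- the summit and its single problem are both named `BirchSwinnertonDyer` (registry layout D-0017)
set_option linter.dupNamespace false

/-!
# WIDTH in tree currency, I: the graded bound `μ(M) ≤ μ(p^n M) + n·μ(M/pM)` and the width certificate
# «`μ(M/pM) ≤ 1 ⟹ [μ(p^nM) = 0 → μ(M) ≤ n]`» for EVERY `Λ`-module (no structure theory)

Seat `bsd-line-k6-p4` (prover-bsd-line-k6-p4-g4-0, 4th LEAD on crux stmt-BirchSwinnertonDyer-20547 `KatoDivisibilityX9`,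
route `OneSidedTwistSqueezeX9`, host cell `bsd-f3-mu`).  THEOREMS ONLY, sorry-free, no definition, no named fact,
nothing asserted about any curve.  `--supports stmt-BirchSwinnertonDyer-20547`.  Line of record
`Cruxes/KatoDivisibilityX9/Lines/graded_euler_loss.lean` (skeleton 089205e1; stubs F1_ζ cite-only / DEPTH ES-C4 /
WIDTH B2).  This file and its sibling `…ResidualWidthX9.lean` serve the WIDTH stub
`stub_widthX9 : SIM.FineMuConcentratedOnClassX9` (the lead's stub; no mechanism on record) by computing it EXACTLY in the
tree's own currency: with `w(M) := μ(M/pM)` (`muInvariant p (M ⧸ (p)•⊤)` — for `M` finitely generated torsion with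
`M_(p) ≅ ⊕_{i<s} Λ_(p)/p^{μ_i}`, `μ_i ≥ 1`, this is `s` = the number of elementary `μ`-divisors = the WIDTH `s_μ(M)` of
MEMO-es §14 = the `Ω`-rank of `M/pM`), B2 at a pair is «`w(X₀) ≤ 1`» and Conjecture A at a pair is «`w(X₀) = 0`»
(sibling file).  Everything is proved from the additivity of local lengths.

* §1 (any commutative ring `R`, any `π ∈ R`, any prime `𝔭`; lengths in `ℕ∞`): the graded pieces `π^jM/π^{j+1}M` are
  successive quotients of `M/πM` (`lengthAt_gradedPiece_succ_le`, via multiplication by `π`), the bookkeeping identity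
  `ℓ(π^jM) = ℓ(π^{j+1}M) + ℓ(π^jM/π^{j+1}M)` (`lengthAt_pow_smul_top_eq_succ_add_gradedPiece`), and the GRADED BOUND
  `lengthAt_le_lengthAt_pow_smul_top_add_mul`: `ℓ_𝔭(M) ≤ ℓ_𝔭(π^n M) + n·ℓ_𝔭(M/πM)`.
* §2 (`Λ = ℤ_p⟦T⟧`, `𝔭 = (p)`): `muInvariant_le_pow_smul_top_add_mul_residualWidth` — **`μ(M) ≤ μ(p^nM) + n·w(M)` for
  EVERY `Λ`-module** (junk cases included), and the WIDTH CERTIFICATE `mu_le_of_residualWidth_le_one` —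
  **`w(M) ≤ 1 ⟹ [μ(p^nM) = 0 → μ(M) ≤ n]`** (generalises p612403's cyclic certificate
  `muInvariant_le_muInvariant_pow_smul_top_add_of_cyclic`: a cyclic `M` has `w ≤ μ(Λ/p) = 1`).

The converses (`[∀ n, μ(p^nM) = 0 → μ(M) ≤ n] ⟹ w(M) ≤ 1` and `μ(M) = 0 ⟺ w(M) = 0` for `M` finitely generated
torsion) and the X9 statements are in the sibling file.  HONEST LABEL: nothing here decides B2 (OPEN); PARTITION
untouched; beyond-print theorem toward BSD: NO; BSD is not proved by any of this.

References: L. Washington, GTM 83, §13.2 (local lengths at `(p)`, `μ = Σ μ_i`) [Washington1997]; S. Lang, *Cyclotomic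
Fields I–II*, Ch. 5 §1 Thm. 1.2 [Lang1990]; HOME/MEMO-es.md §14, §22, §25.6.
-/

noncomputable section

open Literature.NumberTheory.EllipticCurves
open Module IwasawaAlgebra

namespace Summit.BirchSwinnertonDyer.BirchSwinnertonDyer.Theorems.OneSidedTwistSqueezeX9KatoDivisibilityX9ResidualWidth

/-! ## §1 Graded pieces `π^jM/π^{j+1}M` over any commutative ring: local lengths -/

section Graded

variable {R : Type*} [CommRing R] {M : Type*} [AddCommGroup M] [_root_.Module R M] (π : R)
  (𝔭 : PrimeSpectrum R)

/-- `π • x ∈ π^{j+1}M` for `x ∈ π^jM` (`(π)^{j+1} = (π)·(π)^j`). [folklore] -/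
theorem smul_mem_pow_succ_smul_top {j : ℕ} {x : M}
    (hx : x ∈ (Ideal.span {π} ^ j) • (⊤ : Submodule R M)) :
    π • x ∈ (Ideal.span {π} ^ (j + 1)) • (⊤ : Submodule R M) := by
  rw [pow_succ', Submodule.mul_smul]
  exact Submodule.smul_mem_smul (Ideal.mem_span_singleton_self π) hx

/-- Every element of `π^{j+1}M` is `π • x` with `x ∈ π^jM`. [folklore] -/
theorem exists_smul_eq_of_mem_pow_succ_smul_top {j : ℕ} {y : M}
    (hy : y ∈ (Ideal.span {π} ^ (j + 1)) • (⊤ : Submodule R M)) :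
    ∃ x ∈ (Ideal.span {π} ^ j) • (⊤ : Submodule R M), π • x = y := by
  rw [pow_succ', Submodule.mul_smul, Submodule.ideal_span_singleton_smul] at hy
  exact (Submodule.mem_smul_pointwise_iff_exists y π _).mp hy

/-- Multiplication by `π`: `π^jM → π^{j+1}M`, as a linear map (surjective, `surjective_mulToSucc`). [folklore] -/
theorem exists_mulToSucc (j : ℕ) :
    ∃ f : ↥((Ideal.span {π} ^ j) • (⊤ : Submodule R M)) →ₗ[R]
        ↥((Ideal.span {π} ^ (j + 1)) • (⊤ : Submodule R M)),
      Function.Surjective f ∧ (∀ x, (f x : M) = π • (x : M)) := by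
  refine ⟨LinearMap.codRestrict _ (π • ((Ideal.span {π} ^ j) • (⊤ : Submodule R M)).subtype)
      (fun x => smul_mem_pow_succ_smul_top π x.2), ?_, fun x => rfl⟩
  intro y
  obtain ⟨x, hx, hxy⟩ := exists_smul_eq_of_mem_pow_succ_smul_top π y.2
  exact ⟨⟨x, hx⟩, Subtype.ext hxy⟩

/-- **The graded pieces shrink**: `ℓ_𝔭(π^{j+1}M / π^{j+2}M) ≤ ℓ_𝔭(π^jM / π^{j+1}M)` — multiplication by `π`
induces a surjection `π^jM/π·π^jM ↠ π^{j+1}M/π·π^{j+1}M`. [folklore] -/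
theorem lengthAt_gradedPiece_succ_le (j : ℕ) :
    lengthAt R (↥((Ideal.span {π} ^ (j + 1)) • (⊤ : Submodule R M)) ⧸
        (Ideal.span {π} • (⊤ : Submodule R ↥((Ideal.span {π} ^ (j + 1)) • (⊤ : Submodule R M))))) 𝔭 ≤
      lengthAt R (↥((Ideal.span {π} ^ j) • (⊤ : Submodule R M)) ⧸
        (Ideal.span {π} • (⊤ : Submodule R ↥((Ideal.span {π} ^ j) • (⊤ : Submodule R M))))) 𝔭 := by
  obtain ⟨f, hf, hfx⟩ := exists_mulToSucc (M := M) π j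
  have hle : (Ideal.span {π} • (⊤ : Submodule R ↥((Ideal.span {π} ^ j) • (⊤ : Submodule R M)))) ≤
      Submodule.comap f
        (Ideal.span {π} • (⊤ : Submodule R ↥((Ideal.span {π} ^ (j + 1)) • (⊤ : Submodule R M)))) := by
    rw [← Submodule.map_le_iff_le_comap, Submodule.map_smul'']
    exact Submodule.smul_mono le_rfl le_top
  refine lengthAt_le_of_surjective (Submodule.mapQ _ _ f hle) ?_ 𝔭
  intro y
  obtain ⟨y, rfl⟩ := Submodule.mkQ_surjective _ y
  obtain ⟨x, rfl⟩ := hf y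
  exact ⟨Submodule.Quotient.mk x, rfl⟩

/-- `π • (π^jM) = π^{j+1}M` as submodules of `M`: the image of `(π) • ⊤ ⊆ π^jM` under the inclusion.
[folklore] -/
theorem map_subtype_smul_top_pow (j : ℕ) :
    Submodule.map ((Ideal.span {π} ^ j) • (⊤ : Submodule R M)).subtype
        (Ideal.span {π} • (⊤ : Submodule R ↥((Ideal.span {π} ^ j) • (⊤ : Submodule R M)))) =
      (Ideal.span {π} ^ (j + 1)) • (⊤ : Submodule R M) := by
  rw [Submodule.map_smul'', Submodule.map_subtype_top, pow_succ', Submodule.mul_smul]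

/-- `ℓ_𝔭(π · π^jM) = ℓ_𝔭(π^{j+1}M)` (the submodule `(π)•⊤` of `π^jM` IS `π^{j+1}M`). [folklore] -/
theorem lengthAt_smul_top_pow_eq (j : ℕ) :
    lengthAt R ↥(Ideal.span {π} • (⊤ : Submodule R ↥((Ideal.span {π} ^ j) • (⊤ : Submodule R M)))) 𝔭 =
      lengthAt R ↥((Ideal.span {π} ^ (j + 1)) • (⊤ : Submodule R M)) 𝔭 := by
  refine lengthAt_eq_of_linearEquiv ?_ 𝔭
  exact (Submodule.equivMapOfInjective _ (Submodule.injective_subtype _) _).trans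
    (LinearEquiv.ofEq _ _ (map_subtype_smul_top_pow π j))

/-- **Bookkeeping**: `ℓ_𝔭(π^jM) = ℓ_𝔭(π^{j+1}M) + ℓ_𝔭(π^jM/π^{j+1}M)`. [folklore] -/
theorem lengthAt_pow_smul_top_eq_succ_add_gradedPiece (j : ℕ) :
    lengthAt R ↥((Ideal.span {π} ^ j) • (⊤ : Submodule R M)) 𝔭 =
      lengthAt R ↥((Ideal.span {π} ^ (j + 1)) • (⊤ : Submodule R M)) 𝔭 +
        lengthAt R (↥((Ideal.span {π} ^ j) • (⊤ : Submodule R M)) ⧸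
          (Ideal.span {π} • (⊤ : Submodule R ↥((Ideal.span {π} ^ j) • (⊤ : Submodule R M))))) 𝔭 := by
  rw [lengthAt_eq_add_quotient
    (Ideal.span {π} • (⊤ : Submodule R ↥((Ideal.span {π} ^ j) • (⊤ : Submodule R M)))) 𝔭,
    lengthAt_smul_top_pow_eq π 𝔭 j]

/-- `ℓ_𝔭(π^0 M) = ℓ_𝔭(M)`. [folklore] -/
theorem lengthAt_pow_zero_smul_top :
    lengthAt R ↥((Ideal.span {π} ^ 0) • (⊤ : Submodule R M)) 𝔭 = lengthAt R M 𝔭 := by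
  refine lengthAt_eq_of_linearEquiv ?_ 𝔭
  exact (LinearEquiv.ofEq _ _ (by rw [pow_zero, Ideal.one_eq_top, Submodule.top_smul])).trans
    Submodule.topEquiv

/-- `ℓ_𝔭(π^0M / π·π^0M) = ℓ_𝔭(M/πM)`. [folklore] -/
theorem lengthAt_gradedPiece_zero :
    lengthAt R (↥((Ideal.span {π} ^ 0) • (⊤ : Submodule R M)) ⧸
        (Ideal.span {π} • (⊤ : Submodule R ↥((Ideal.span {π} ^ 0) • (⊤ : Submodule R M))))) 𝔭 =
      lengthAt R (M ⧸ Ideal.span {π} • (⊤ : Submodule R M)) 𝔭 := by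
  have htop : (Ideal.span {π} ^ 0) • (⊤ : Submodule R M) = ⊤ := by
    rw [pow_zero, Ideal.one_eq_top, Submodule.top_smul]
  let e : ↥((Ideal.span {π} ^ 0) • (⊤ : Submodule R M)) ≃ₗ[R] M :=
    (LinearEquiv.ofEq _ _ htop).trans Submodule.topEquiv
  refine lengthAt_eq_of_linearEquiv (Submodule.Quotient.equiv _ _ e ?_) 𝔭
  rw [Submodule.map_smul'', Submodule.map_top, LinearEquiv.range]

/-- **The graded bound (any ring)**: `ℓ_𝔭(π^jM) ≤ ℓ_𝔭(π^{j+n}M) + n · ℓ_𝔭(π^jM/π^{j+1}M)` for all `j, n`.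
[folklore] -/
theorem lengthAt_pow_smul_top_le_add_mul (j n : ℕ) :
    lengthAt R ↥((Ideal.span {π} ^ j) • (⊤ : Submodule R M)) 𝔭 ≤
      lengthAt R ↥((Ideal.span {π} ^ (j + n)) • (⊤ : Submodule R M)) 𝔭 +
        n * lengthAt R (↥((Ideal.span {π} ^ j) • (⊤ : Submodule R M)) ⧸
          (Ideal.span {π} • (⊤ : Submodule R ↥((Ideal.span {π} ^ j) • (⊤ : Submodule R M))))) 𝔭 := by
  induction n generalizing j with
  | zero => simp
  | succ n ih =>
    rw [lengthAt_pow_smul_top_eq_succ_add_gradedPiece π 𝔭 j]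
    have h1 := ih (j + 1)
    have h2 := lengthAt_gradedPiece_succ_le (M := M) π 𝔭 j
    have h3 : j + 1 + n = j + (n + 1) := by ring
    rw [h3] at h1
    calc lengthAt R ↥((Ideal.span {π} ^ (j + 1)) • (⊤ : Submodule R M)) 𝔭 +
          lengthAt R (↥((Ideal.span {π} ^ j) • (⊤ : Submodule R M)) ⧸
            (Ideal.span {π} • (⊤ : Submodule R ↥((Ideal.span {π} ^ j) • (⊤ : Submodule R M))))) 𝔭
        ≤ (lengthAt R ↥((Ideal.span {π} ^ (j + (n + 1))) • (⊤ : Submodule R M)) 𝔭 +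
            n * lengthAt R (↥((Ideal.span {π} ^ j) • (⊤ : Submodule R M)) ⧸
              (Ideal.span {π} • (⊤ : Submodule R ↥((Ideal.span {π} ^ j) • (⊤ : Submodule R M))))) 𝔭) +
          lengthAt R (↥((Ideal.span {π} ^ j) • (⊤ : Submodule R M)) ⧸
            (Ideal.span {π} • (⊤ : Submodule R ↥((Ideal.span {π} ^ j) • (⊤ : Submodule R M))))) 𝔭 := by
          gcongr
          exact h1.trans (by gcongr)
      _ = _ := by push_cast; ring

/-- **The graded bound at `j = 0` (any ring)**: `ℓ_𝔭(M) ≤ ℓ_𝔭(π^n M) + n · ℓ_𝔭(M/πM)`. [folklore] -/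
theorem lengthAt_le_lengthAt_pow_smul_top_add_mul (n : ℕ) :
    lengthAt R M 𝔭 ≤ lengthAt R ↥((Ideal.span {π} ^ n) • (⊤ : Submodule R M)) 𝔭 +
      n * lengthAt R (M ⧸ Ideal.span {π} • (⊤ : Submodule R M)) 𝔭 := by
  have h := lengthAt_pow_smul_top_le_add_mul (M := M) π 𝔭 0 n
  rwa [lengthAt_pow_zero_smul_top, lengthAt_gradedPiece_zero, zero_add] at h

end Graded

/-! ## §2 Over `Λ = ℤ_p⟦T⟧` at `𝔭 = (p)`: `μ(M) ≤ μ(p^nM) + n·μ(M/pM)`, the width certificate and its converse -/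

section Lambda

variable {p : ℕ} [Fact p.Prime] {M : Type*} [AddCommGroup M] [_root_.Module (IwasawaAlgebra p) M]

/-- **`μ(M) ≤ μ(p^n M) + n · μ(M/pM)` for EVERY `Λ`-module `M`** (junk cases included: if `ℓ_(p)(M) = ∞` the left
side is the junk value `0`).  With `w := μ(M/pM)` the number of elementary `μ`-divisors of a finitely generated torsion
`M`, this is `Σ μ_i ≤ Σ max(μ_i − n, 0) + n·#{i}`. [cite: Washington1997, §13.2] -/
theorem muInvariant_le_pow_smul_top_add_mul_residualWidth (n : ℕ) :
    muInvariant p M ≤ muInvariant p ↥((augIdealP p ^ n) • (⊤ : Submodule (IwasawaAlgebra p) M)) +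
      n * muInvariant p (M ⧸ augIdealP p • (⊤ : Submodule (IwasawaAlgebra p) M)) := by
  let 𝔭 : PrimeSpectrum (IwasawaAlgebra p) := ⟨augIdealP p, isPrime_augIdealP_holds p⟩
  have h := lengthAt_le_lengthAt_pow_smul_top_add_mul (M := M) (PowerSeries.C (p : ℤ_[p]) : IwasawaAlgebra p) 𝔭 n
  change lengthAt (IwasawaAlgebra p) M 𝔭 ≤
    lengthAt (IwasawaAlgebra p) ↥((augIdealP p ^ n) • (⊤ : Submodule (IwasawaAlgebra p) M)) 𝔭 +
      n * lengthAt (IwasawaAlgebra p) (M ⧸ augIdealP p • (⊤ : Submodule (IwasawaAlgebra p) M)) 𝔭 at h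
  rw [muInvariant_eq_toNat_lengthAt p M 𝔭 rfl,
    muInvariant_eq_toNat_lengthAt p (↥((augIdealP p ^ n) • (⊤ : Submodule (IwasawaAlgebra p) M))) 𝔭 rfl,
    muInvariant_eq_toNat_lengthAt p (M ⧸ augIdealP p • (⊤ : Submodule (IwasawaAlgebra p) M)) 𝔭 rfl]
  by_cases hM : lengthAt (IwasawaAlgebra p) M 𝔭 = ⊤
  · rw [hM]; simp
  have hN : lengthAt (IwasawaAlgebra p) ↥((augIdealP p ^ n) • (⊤ : Submodule (IwasawaAlgebra p) M)) 𝔭 ≠ ⊤ :=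
    ne_top_of_le_ne_top hM (lengthAt_submodule_le _ 𝔭)
  have hQ : lengthAt (IwasawaAlgebra p) (M ⧸ augIdealP p • (⊤ : Submodule (IwasawaAlgebra p) M)) 𝔭 ≠ ⊤ :=
    ne_top_of_le_ne_top hM (lengthAt_quotient_le _ 𝔭)
  obtain ⟨a, ha⟩ := ENat.ne_top_iff_exists.mp hM
  obtain ⟨b, hb⟩ := ENat.ne_top_iff_exists.mp hN
  obtain ⟨c, hc⟩ := ENat.ne_top_iff_exists.mp hQ
  rw [← ha, ← hb, ← hc] at h ⊢
  simp only [ENat.toNat_coe]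
  exact_mod_cast h

/-- **The WIDTH CERTIFICATE: `μ(M/pM) ≤ 1 ⟹ [μ(p^nM) = 0 → μ(M) ≤ n]`**, for every `Λ`-module `M` and every `n`
(a cyclic `M` has `μ(M/pM) ≤ μ(Λ/p) = 1`, so this contains p612403's cyclic certificate). [cite: Washington1997, §13.2] -/
theorem mu_le_of_residualWidth_le_one
    (hw : muInvariant p (M ⧸ augIdealP p • (⊤ : Submodule (IwasawaAlgebra p) M)) ≤ 1) (n : ℕ)
    (h0 : muInvariant p ↥((augIdealP p ^ n) • (⊤ : Submodule (IwasawaAlgebra p) M)) = 0) :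
    muInvariant p M ≤ n := by
  have h := muInvariant_le_pow_smul_top_add_mul_residualWidth (p := p) (M := M) n
  rw [h0, zero_add] at h
  calc muInvariant p M ≤ n * muInvariant p (M ⧸ augIdealP p • (⊤ : Submodule (IwasawaAlgebra p) M)) := h
    _ ≤ n * 1 := Nat.mul_le_mul_left n hw
    _ = n := mul_one n

end Lambda

end Summit.BirchSwinnertonDyer.BirchSwinnertonDyer.Theorems.OneSidedTwistSqueezeX9KatoDivisibilityX9ResidualWidth

end
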